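import Summits.SmoothPoincare4.SmoothPoincare4.Theorems.RootDecompAEDoublesShadowLEOnePeelDefs

/-!
# Peeling theorem for KMN encoding graphs, part 3/8: the local table (★)

§4 For each of the twelve pieces (pair of pants, eleven figure-eight blocks): a single port word with unit
exponent (rank one) IS the letter `a` (`localTable_rank_one`), and every ordered pair of distinct port words whose
`2 × 2` exponent matrix is unimodular is SIGNED TRIANGULAR — one of the two words, possibly inverted, is a letter and
the other, possibly inverted and with that letter erased, is the other letter (`localTable_rank_two`).  Finitely
many closed free-group identities, each discharged by `decide`.

THE FAMILY (eight modules `Theorems/RootDecompAEDoublesShadowLEOnePeel*.lean` + the closing module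
`Theorems/RootDecompAEDoublesShadowLEOneStubPeelCertificates.lean`, one namespace
`Summit.SmoothPoincare4.SmoothPoincare4.Theorems.RootDecompAEDoublesShadowLEOneStubPeelCertificates`, split by topic to respect the
400-line bound on proof files): `…PeelDefs` (verbatim twins of the skeleton's `Piece`, `ShadowGraph`,
`PeelCertificates`; free-group exponent sums; `H₁ = 0 ⟹` unimodular exponent matrix) · `…PeelBlocks` (unimodular
finset-indexed blocks of an integer table: splitting and rank bounds; the tree of pieces and its leaves) ·
`…PeelLocalTable` (the local table (★) of the twelve pieces) · `…PeelTable` (exponent sums of the relators of `P(G)`;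
rows and used letters of a peeling state) · `…PeelLocalStep` (the geometry of a gluing at a piece; local certificate
data from local unimodularity) · `…PeelCombine` (certificates of peeling states; the combination step; the set
algebra of one peeling step) · `…PeelRecursion` (the peeling recursion; the unimodular start) ·
`…StubPeelCertificates` (step L0 and the extraction: `theorem stub_peelCertificates : PeelCertificates`).
-/

open Function
open Literature.Topology.FourManifolds

set_option linter.dupNamespace false

noncomputable section

namespace Summit.SmoothPoincare4.SmoothPoincare4.Theorems.RootDecompAEDoublesShadowLEOneStubPeelCertificates

/-! ## §4 The local table (★): unimodular configurations of port words are signed triangular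

For a rank-two piece, a pair of distinct port words whose `2 × 2` exponent matrix is unimodular admits a LOCAL
CERTIFICATE (one word is a letter up to sign, the other becomes the other letter up to sign once that letter is erased);
for a rank-one piece, a port word with unit exponent is the letter itself.  All `1 + 11` rank-two pieces and the four
rank-one pieces are checked by exhaustion over ordered pairs of ports (`decide` evaluates the closed free-group words). -/

section LocalTable

/-- LOCAL CERTIFICATE of a `Bool`-indexed pair of words in `F(a, b)`: distinct owner letters `o`, signs `t` and local
ranks `lr < 2` of the two letters such that the `b`-th word, signed by `t b` and with the letters of local rank below
that of `o b` erased, IS the letter `o b`. -/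
def LocalCert2 (w : Bool → FreeGroup (Fin 2)) : Prop :=
  ∃ (o : Bool → Fin 2) (t : Bool → Bool) (lr : Fin 2 → ℕ), o true ≠ o false ∧ (∀ j, lr j < 2) ∧
    ∀ b, FreeGroup.lift (fun j : Fin 2 => if lr j < lr (o b) then (1 : FreeGroup (Fin 2)) else FreeGroup.of j)
      (sgnw (t b) (w b)) = FreeGroup.of (o b)

/-- Building a local certificate from explicit data: the word `w bl` is the letter `x` up to the sign `tl`, and the
other word with `x` erased is the other letter `y` up to the sign `th`. -/
theorem localCert2_of (w : Bool → FreeGroup (Fin 2)) (bl : Bool) (x y : Fin 2) (hxy : x ≠ y) (tl th : Bool)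
    (hl : sgnw tl (w bl) = FreeGroup.of x)
    (hh : FreeGroup.lift (fun j : Fin 2 => if j = x then (1 : FreeGroup (Fin 2)) else FreeGroup.of j)
      (sgnw th (w (!bl))) = FreeGroup.of y) : LocalCert2 w := by
  refine ⟨fun b => if b = bl then x else y, fun b => if b = bl then tl else th,
    fun j => if j = x then 0 else 1, ?_, ?_, ?_⟩
  · cases bl <;> simp [hxy, hxy.symm]
  · intro j
    dsimp only
    split_ifs <;> omega
  · intro b
    by_cases hb : b = bl
    · subst hb
      have e : (fun j : Fin 2 => if (if j = x then (0 : ℕ) else 1) < 0 then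
          (1 : FreeGroup (Fin 2)) else FreeGroup.of j) = FreeGroup.of := by
        funext j
        simp
      simp only [if_true]
      rw [e, FreeGroup.lift_of_eq_id]
      simpa using hl
    · have hb' : (!bl) = b := by
        cases b <;> cases bl <;> simp_all
      have e : (fun j : Fin 2 => if (if j = x then (0 : ℕ) else 1) < 1 then
          (1 : FreeGroup (Fin 2)) else FreeGroup.of j) = fun j => if j = x then 1 else FreeGroup.of j := by
        funext j
        by_cases hj : j = x <;> simp [hj]
      simp only [hb, if_false, if_neg (Ne.symm hxy)]
      rw [e, ← hb']
      exact hh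

/-- (★, rank one) A port word of a rank-one piece with unit exponent is the letter `a` itself. -/
theorem localTable_rank_one (p : Piece) (hp : p.rank = 1) (j : ℕ) (hj : j < p.numPorts)
    (hu : IsUnit (expo 0 (p.portWord j))) : p.portWord j = FreeGroup.of 0 := by
  cases p with
  | disc => simp [Piece.rank] at hp
  | pants => simp [Piece.rank] at hp
  | moebius =>
    have hj' : j < 1 := lt_of_lt_of_eq hj (by decide)
    interval_cases j
    exact absurd hu (by rw [Int.isUnit_iff]; decide)
  | y111 =>
    have hj' : j < 3 := lt_of_lt_of_eq hj (by decide)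
    interval_cases j <;> decide
  | y12 =>
    have hj' : j < 2 := lt_of_lt_of_eq hj (by decide)
    interval_cases j
    · decide
    · exact absurd hu (by rw [Int.isUnit_iff]; decide)
  | y3 =>
    have hj' : j < 1 := lt_of_lt_of_eq hj (by decide)
    interval_cases j
    exact absurd hu (by rw [Int.isUnit_iff]; decide)
  | x8 i => simp [Piece.rank] at hp

/-- (★) Local table, pants `[a, b, ab]`: every pair of distinct ports is unimodular and signed triangular. -/
theorem localTable_pants (i j : ℕ) (hi : i < (Piece.pants).numPorts) (hj : j < (Piece.pants).numPorts) (hij : i ≠ j)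
    (hu : IsUnit (expo 0 ((Piece.pants).portWord i) * expo 1 ((Piece.pants).portWord j) -
      expo 1 ((Piece.pants).portWord i) * expo 0 ((Piece.pants).portWord j))) :
    LocalCert2 (fun b => if b then (Piece.pants).portWord i else (Piece.pants).portWord j) := by
  have hi' : i < 3 := lt_of_lt_of_eq hi (by decide)
  have hj' : j < 3 := lt_of_lt_of_eq hj (by decide)
  clear hi hj
  interval_cases i <;> interval_cases j
  · exact absurd rfl hij
  · exact localCert2_of _ true 0 1 (by decide) false false (by decide) (by decide)
  · exact localCert2_of _ true 0 1 (by decide) false false (by decide) (by decide)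
  · exact localCert2_of _ true 1 0 (by decide) false false (by decide) (by decide)
  · exact absurd rfl hij
  · exact localCert2_of _ true 1 0 (by decide) false false (by decide) (by decide)
  · exact localCert2_of _ false 0 1 (by decide) false false (by decide) (by decide)
  · exact localCert2_of _ false 1 0 (by decide) false false (by decide) (by decide)
  · exact absurd rfl hij

/-- (★) Local table, figure-eight block 0 `['a', 'abAB', 'b']`: unimodular pairs of distinct ports are signed triangular. -/
theorem localTable_x8_0 (i j : ℕ) (hi : i < (Piece.x8 0).numPorts) (hj : j < (Piece.x8 0).numPorts) (hij : i ≠ j)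
    (hu : IsUnit (expo 0 ((Piece.x8 0).portWord i) * expo 1 ((Piece.x8 0).portWord j) -
      expo 1 ((Piece.x8 0).portWord i) * expo 0 ((Piece.x8 0).portWord j))) :
    LocalCert2 (fun b => if b then (Piece.x8 0).portWord i else (Piece.x8 0).portWord j) := by
  have hi' : i < 3 := lt_of_lt_of_eq hi (by decide)
  have hj' : j < 3 := lt_of_lt_of_eq hj (by decide)
  clear hi hj
  interval_cases i <;> interval_cases j
  · exact absurd rfl hij
  · exact absurd hu (by rw [Int.isUnit_iff]; decide)
  · exact localCert2_of _ true 0 1 (by decide) false false (by decide) (by decide)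
  · exact absurd hu (by rw [Int.isUnit_iff]; decide)
  · exact absurd rfl hij
  · exact absurd hu (by rw [Int.isUnit_iff]; decide)
  · exact localCert2_of _ true 1 0 (by decide) false false (by decide) (by decide)
  · exact absurd hu (by rw [Int.isUnit_iff]; decide)
  · exact absurd rfl hij

/-- (★) Local table, figure-eight block 1 `['a', 'abbAB']`: unimodular pairs of distinct ports are signed triangular. -/
theorem localTable_x8_1 (i j : ℕ) (hi : i < (Piece.x8 1).numPorts) (hj : j < (Piece.x8 1).numPorts) (hij : i ≠ j)
    (hu : IsUnit (expo 0 ((Piece.x8 1).portWord i) * expo 1 ((Piece.x8 1).portWord j) -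
      expo 1 ((Piece.x8 1).portWord i) * expo 0 ((Piece.x8 1).portWord j))) :
    LocalCert2 (fun b => if b then (Piece.x8 1).portWord i else (Piece.x8 1).portWord j) := by
  have hi' : i < 2 := lt_of_lt_of_eq hi (by decide)
  have hj' : j < 2 := lt_of_lt_of_eq hj (by decide)
  clear hi hj
  interval_cases i <;> interval_cases j
  · exact absurd rfl hij
  · exact localCert2_of _ true 0 1 (by decide) false false (by decide) (by decide)
  · exact localCert2_of _ false 0 1 (by decide) false false (by decide) (by decide)
  · exact absurd rfl hij

/-- (★) Local table, figure-eight block 2 `['a', 'abaB', 'b']`: unimodular pairs of distinct ports are signed triangular. -/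
theorem localTable_x8_2 (i j : ℕ) (hi : i < (Piece.x8 2).numPorts) (hj : j < (Piece.x8 2).numPorts) (hij : i ≠ j)
    (hu : IsUnit (expo 0 ((Piece.x8 2).portWord i) * expo 1 ((Piece.x8 2).portWord j) -
      expo 1 ((Piece.x8 2).portWord i) * expo 0 ((Piece.x8 2).portWord j))) :
    LocalCert2 (fun b => if b then (Piece.x8 2).portWord i else (Piece.x8 2).portWord j) := by
  have hi' : i < 3 := lt_of_lt_of_eq hi (by decide)
  have hj' : j < 3 := lt_of_lt_of_eq hj (by decide)
  clear hi hj
  interval_cases i <;> interval_cases j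
  · exact absurd rfl hij
  · exact absurd hu (by rw [Int.isUnit_iff]; decide)
  · exact localCert2_of _ true 0 1 (by decide) false false (by decide) (by decide)
  · exact absurd hu (by rw [Int.isUnit_iff]; decide)
  · exact absurd rfl hij
  · exact absurd hu (by rw [Int.isUnit_iff]; decide)
  · exact localCert2_of _ true 1 0 (by decide) false false (by decide) (by decide)
  · exact absurd hu (by rw [Int.isUnit_iff]; decide)
  · exact absurd rfl hij

/-- (★) Local table, figure-eight block 3 `['a', 'abbaB']`: unimodular pairs of distinct ports are signed triangular. -/
theorem localTable_x8_3 (i j : ℕ) (hi : i < (Piece.x8 3).numPorts) (hj : j < (Piece.x8 3).numPorts) (hij : i ≠ j)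
    (hu : IsUnit (expo 0 ((Piece.x8 3).portWord i) * expo 1 ((Piece.x8 3).portWord j) -
      expo 1 ((Piece.x8 3).portWord i) * expo 0 ((Piece.x8 3).portWord j))) :
    LocalCert2 (fun b => if b then (Piece.x8 3).portWord i else (Piece.x8 3).portWord j) := by
  have hi' : i < 2 := lt_of_lt_of_eq hi (by decide)
  have hj' : j < 2 := lt_of_lt_of_eq hj (by decide)
  clear hi hj
  interval_cases i <;> interval_cases j
  · exact absurd rfl hij
  · exact localCert2_of _ true 0 1 (by decide) false false (by decide) (by decide)
  · exact localCert2_of _ false 0 1 (by decide) false false (by decide) (by decide)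
  · exact absurd rfl hij

/-- (★) Local table, figure-eight block 4 `['a', 'aBBAB']`: unimodular pairs of distinct ports are signed triangular. -/
theorem localTable_x8_4 (i j : ℕ) (hi : i < (Piece.x8 4).numPorts) (hj : j < (Piece.x8 4).numPorts) (hij : i ≠ j)
    (hu : IsUnit (expo 0 ((Piece.x8 4).portWord i) * expo 1 ((Piece.x8 4).portWord j) -
      expo 1 ((Piece.x8 4).portWord i) * expo 0 ((Piece.x8 4).portWord j))) :
    LocalCert2 (fun b => if b then (Piece.x8 4).portWord i else (Piece.x8 4).portWord j) := by
  have hi' : i < 2 := lt_of_lt_of_eq hi (by decide)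
  have hj' : j < 2 := lt_of_lt_of_eq hj (by decide)
  clear hi hj
  interval_cases i <;> interval_cases j
  · exact absurd rfl hij
  · exact absurd hu (by rw [Int.isUnit_iff]; decide)
  · exact absurd hu (by rw [Int.isUnit_iff]; decide)
  · exact absurd rfl hij

/-- (★) Local table, figure-eight block 5 `['a', 'aB', 'ab', 'b']`: unimodular pairs of distinct ports are signed triangular. -/
theorem localTable_x8_5 (i j : ℕ) (hi : i < (Piece.x8 5).numPorts) (hj : j < (Piece.x8 5).numPorts) (hij : i ≠ j)
    (hu : IsUnit (expo 0 ((Piece.x8 5).portWord i) * expo 1 ((Piece.x8 5).portWord j) -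
      expo 1 ((Piece.x8 5).portWord i) * expo 0 ((Piece.x8 5).portWord j))) :
    LocalCert2 (fun b => if b then (Piece.x8 5).portWord i else (Piece.x8 5).portWord j) := by
  have hi' : i < 4 := lt_of_lt_of_eq hi (by decide)
  have hj' : j < 4 := lt_of_lt_of_eq hj (by decide)
  clear hi hj
  interval_cases i <;> interval_cases j
  · exact absurd rfl hij
  · exact localCert2_of _ true 0 1 (by decide) false true (by decide) (by decide)
  · exact localCert2_of _ true 0 1 (by decide) false false (by decide) (by decide)
  · exact localCert2_of _ true 0 1 (by decide) false false (by decide) (by decide)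
  · exact localCert2_of _ false 0 1 (by decide) false true (by decide) (by decide)
  · exact absurd rfl hij
  · exact absurd hu (by rw [Int.isUnit_iff]; decide)
  · exact localCert2_of _ false 1 0 (by decide) false false (by decide) (by decide)
  · exact localCert2_of _ false 0 1 (by decide) false false (by decide) (by decide)
  · exact absurd hu (by rw [Int.isUnit_iff]; decide)
  · exact absurd rfl hij
  · exact localCert2_of _ false 1 0 (by decide) false false (by decide) (by decide)
  · exact localCert2_of _ true 1 0 (by decide) false false (by decide) (by decide)
  · exact localCert2_of _ true 1 0 (by decide) false false (by decide) (by decide)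
  · exact localCert2_of _ true 1 0 (by decide) false false (by decide) (by decide)
  · exact absurd rfl hij

/-- (★) Local table, figure-eight block 6 `['a', 'aB', 'abb']`: unimodular pairs of distinct ports are signed triangular. -/
theorem localTable_x8_6 (i j : ℕ) (hi : i < (Piece.x8 6).numPorts) (hj : j < (Piece.x8 6).numPorts) (hij : i ≠ j)
    (hu : IsUnit (expo 0 ((Piece.x8 6).portWord i) * expo 1 ((Piece.x8 6).portWord j) -
      expo 1 ((Piece.x8 6).portWord i) * expo 0 ((Piece.x8 6).portWord j))) :
    LocalCert2 (fun b => if b then (Piece.x8 6).portWord i else (Piece.x8 6).portWord j) := by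
  have hi' : i < 3 := lt_of_lt_of_eq hi (by decide)
  have hj' : j < 3 := lt_of_lt_of_eq hj (by decide)
  clear hi hj
  interval_cases i <;> interval_cases j
  · exact absurd rfl hij
  · exact localCert2_of _ true 0 1 (by decide) false true (by decide) (by decide)
  · exact absurd hu (by rw [Int.isUnit_iff]; decide)
  · exact localCert2_of _ false 0 1 (by decide) false true (by decide) (by decide)
  · exact absurd rfl hij
  · exact absurd hu (by rw [Int.isUnit_iff]; decide)
  · exact absurd hu (by rw [Int.isUnit_iff]; decide)
  · exact absurd hu (by rw [Int.isUnit_iff]; decide)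
  · exact absurd rfl hij

/-- (★) Local table, figure-eight block 7 `['abbABa']`: unimodular pairs of distinct ports are signed triangular. -/
theorem localTable_x8_7 (i j : ℕ) (hi : i < (Piece.x8 7).numPorts) (hj : j < (Piece.x8 7).numPorts) (hij : i ≠ j)
    (hu : IsUnit (expo 0 ((Piece.x8 7).portWord i) * expo 1 ((Piece.x8 7).portWord j) -
      expo 1 ((Piece.x8 7).portWord i) * expo 0 ((Piece.x8 7).portWord j))) :
    LocalCert2 (fun b => if b then (Piece.x8 7).portWord i else (Piece.x8 7).portWord j) := by
  have hi' : i < 1 := lt_of_lt_of_eq hi (by decide)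
  have hj' : j < 1 := lt_of_lt_of_eq hj (by decide)
  clear hi hj
  interval_cases i; interval_cases j
  exact absurd rfl hij

/-- (★) Local table, figure-eight block 8 `['abbaBa']`: unimodular pairs of distinct ports are signed triangular. -/
theorem localTable_x8_8 (i j : ℕ) (hi : i < (Piece.x8 8).numPorts) (hj : j < (Piece.x8 8).numPorts) (hij : i ≠ j)
    (hu : IsUnit (expo 0 ((Piece.x8 8).portWord i) * expo 1 ((Piece.x8 8).portWord j) -
      expo 1 ((Piece.x8 8).portWord i) * expo 0 ((Piece.x8 8).portWord j))) :
    LocalCert2 (fun b => if b then (Piece.x8 8).portWord i else (Piece.x8 8).portWord j) := by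
  have hi' : i < 1 := lt_of_lt_of_eq hi (by decide)
  have hj' : j < 1 := lt_of_lt_of_eq hj (by decide)
  clear hi hj
  interval_cases i; interval_cases j
  exact absurd rfl hij

/-- (★) Local table, figure-eight block 9 `['abba', 'aB']`: unimodular pairs of distinct ports are signed triangular. -/
theorem localTable_x8_9 (i j : ℕ) (hi : i < (Piece.x8 9).numPorts) (hj : j < (Piece.x8 9).numPorts) (hij : i ≠ j)
    (hu : IsUnit (expo 0 ((Piece.x8 9).portWord i) * expo 1 ((Piece.x8 9).portWord j) -
      expo 1 ((Piece.x8 9).portWord i) * expo 0 ((Piece.x8 9).portWord j))) :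
    LocalCert2 (fun b => if b then (Piece.x8 9).portWord i else (Piece.x8 9).portWord j) := by
  have hi' : i < 2 := lt_of_lt_of_eq hi (by decide)
  have hj' : j < 2 := lt_of_lt_of_eq hj (by decide)
  clear hi hj
  interval_cases i <;> interval_cases j
  · exact absurd rfl hij
  · exact absurd hu (by rw [Int.isUnit_iff]; decide)
  · exact absurd hu (by rw [Int.isUnit_iff]; decide)
  · exact absurd rfl hij

/-- (★) Local table, figure-eight block 10 `['aba', 'aBB']`: unimodular pairs of distinct ports are signed triangular. -/
theorem localTable_x8_10 (i j : ℕ) (hi : i < (Piece.x8 10).numPorts) (hj : j < (Piece.x8 10).numPorts) (hij : i ≠ j)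
    (hu : IsUnit (expo 0 ((Piece.x8 10).portWord i) * expo 1 ((Piece.x8 10).portWord j) -
      expo 1 ((Piece.x8 10).portWord i) * expo 0 ((Piece.x8 10).portWord j))) :
    LocalCert2 (fun b => if b then (Piece.x8 10).portWord i else (Piece.x8 10).portWord j) := by
  have hi' : i < 2 := lt_of_lt_of_eq hi (by decide)
  have hj' : j < 2 := lt_of_lt_of_eq hj (by decide)
  clear hi hj
  interval_cases i <;> interval_cases j
  · exact absurd rfl hij
  · exact absurd hu (by rw [Int.isUnit_iff]; decide)
  · exact absurd hu (by rw [Int.isUnit_iff]; decide)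
  · exact absurd rfl hij

/-- (★, rank two) For a rank-two piece, two distinct ports whose `2 × 2` exponent matrix is unimodular admit a local
certificate (dispatch over the pants and the eleven figure-eight blocks). -/
theorem localTable_rank_two (p : Piece) (hp : p.rank = 2) (i j : ℕ) (hi : i < p.numPorts) (hj : j < p.numPorts)
    (hij : i ≠ j) (hu : IsUnit (expo 0 (p.portWord i) * expo 1 (p.portWord j) -
      expo 1 (p.portWord i) * expo 0 (p.portWord j))) :
    LocalCert2 (fun b => if b then p.portWord i else p.portWord j) := by
  cases p with
  | disc => simp [Piece.rank] at hp
  | pants => exact localTable_pants i j hi hj hij hu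
  | moebius => simp [Piece.rank] at hp
  | y111 => simp [Piece.rank] at hp
  | y12 => simp [Piece.rank] at hp
  | y3 => simp [Piece.rank] at hp
  | x8 idx =>
    fin_cases idx
    · exact localTable_x8_0 i j hi hj hij hu
    · exact localTable_x8_1 i j hi hj hij hu
    · exact localTable_x8_2 i j hi hj hij hu
    · exact localTable_x8_3 i j hi hj hij hu
    · exact localTable_x8_4 i j hi hj hij hu
    · exact localTable_x8_5 i j hi hj hij hu
    · exact localTable_x8_6 i j hi hj hij hu
    · exact localTable_x8_7 i j hi hj hij hu
    · exact localTable_x8_8 i j hi hj hij hu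
    · exact localTable_x8_9 i j hi hj hij hu
    · exact localTable_x8_10 i j hi hj hij hu

end LocalTable

end Summit.SmoothPoincare4.SmoothPoincare4.Theorems.RootDecompAEDoublesShadowLEOneStubPeelCertificates
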